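import Literature.MathematicalPhysics.QuantumFieldTheory.Balaban1983to89.B6GlobalChartV1
import Literature.MathematicalPhysics.QuantumFieldTheory.Balaban1983to89.B6Ineq268MultiLevelBox

/-!
# `Balaban1983to89.B6ScalarChartV1` — T. Bałaban, *Propagators and renormalization transformations for lattice gauge theories. II*, Commun. Math.
# Phys. **96** (1984) 223–250 [Balaban1984PropagatorsII], (2.13)–(2.17) p. 225, (2.88) p. 238: THE SCALAR DICTIONARY between the V1 global torus
# `T_η = Site P 0` over r03's `domT` (the carrier of `Δ_a`, `R = RE`, `∂P∂* = ∂(1 − R)∂*` of `B6SectAVectorModelV1`/`B6SectAOperatorsV1`) and p21's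
# torus matrices on the fundamental box `Π_μ[0, N_μ)` (`perLapT`, `mlOpT` of `B6MultiLevelTorusOperator`, the block average `QB`) along the identity
# chart `toBox`/`boxEquiv`: Laplacian ↔ Laplacian, gauge space `N(Q′)` ↔ `N(Q′)`, `R` ↔ THE orthogonal projection onto `ΔN(Q′)`, the kernel of
# `∂P∂*`, and the transfer of a (2.88)-type entry bound to the block majorant on `geomT` (ROUTE V, B6-CLOSURE.md §5 items 7–11, input (d2)/(d5-b))

statement-level skeleton of published theorems with citation tags; proofs where landed; nothing here is a claim about the Yang–Mills mass gap

PDF held: `paper:balaban1984-cmp96-propagators-rt-ii` (journal page = PDF page + 222); p. 225 [PDF 3] ((2.13)–(2.17)), p. 238 [PDF 16] ((2.88)), p. 239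
[PDF 17] ((2.90)–(2.92)) re-read from the materialised text `~/.lit/texts/paper-balaban1984-cmp96-propagators-rt-ii/p0003.txt`, `p0016.txt`,
`p0017.txt` (this seat, 2026-08-23).

PRINT (verbatim up to notation).  p. 225: *"let R be an orthogonal projection in the space L²(T_η) onto the subspace ΔN(Q′). … Rf = Δλ = Δ′_aλ =
(I − G′Q′*(Q′G′²Q′*)⁻¹Q′G′)f. (2.17)"*; p. 226: *"Δ_a = ∂*∂ + ∂R∂* + Q*aQ = Δ − ∂P∂* + Q*aQ, (2.19)"*; p. 238: *"Finally let us consider the kernel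
of the operator ∂P∂* appearing in ∂R∂*, R = I − P given by (2.18). We have from Lemma 2.1, Proposition 2.2 and (2.87),
|(∂_μP∂_ν*)(x, x′)| ≤ O(1)(L^jη)^{−2}(L^{j′}η)^{−d}e^{−δ₂d(y,y′)} (2.88) where x ∈ B^j(y), x′ ∈ B^{j′}(y′), y ∈ Λ_j, y′ ∈ Λ_{j′}"*;
p. 224: *"we admit the case when some domains Ω_j are equal to T_η"*.

CITATION HEADER (lean-in-tree rule) — WHAT IS REPRODUCED.  Phase-2 file of the `lit-balaban` typed skeleton (HOME `run/shared/lean/pub/lit-balaban/`),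
seat **p22 gen 19**, item (b) TAKEN at the B6 fold owner's request (r03 g19, lit-balaban-p22/INBOX.md 2026-08-23T02:32:05Z: *"please TAKE the scalar
V1 ↔ torus-matrix dictionary over `domT`"*); SKELETON rows **B6.Eq2.17** × **B6.Eq2.88** × **B6.Prop2.6** (cells only; no decl of record touched; referee
ref-4).  ROUTE V of B6-CLOSURE §5 item 7 runs the genuine `k`-level Proposition 2.6 on the V1 global torus `PBond (PV d ℓ m K) 0` with `Δ_a :=
deltaAE (domT hN D hk) c w` (r03's `B6GlobalChartV1`), whose projection part is `Dg := onFun (dE c ∘ (1 − RE) ∘ dsE c)` (`B6AgreeLapV1Chart.deltaAE_split`);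
the (2.88) majorant of `Dg` (the `hDg`/`hPl` slot of p38's `B6Ineq2134KFamKLevelTorus.h2134_kFam_torus`) is proved by p21 for THEIR torus matrices
(`B6Ineq288MultiLevelTorus`, in flight).  THIS FILE is the dictionary between the two carriers, CONSUMER-AGNOSTIC on p21's side (the torus `R` enters as
ANY matrix `Rm` with the three defining properties of the orthogonal projection onto `Δ′_aN(Q′)` — symmetric, range inside, fixing — which p21's
`rM_transpose`/`rM_mulVec_eq`/`rM_mulVec_dP_of_ker`-type lemmas supply):
* §1 the chart and the lattice translations: `toBox_shift`/`toBox_unshift` (`toBox (x ± e_μ) = tshift (±e_μ) (toBox x)`).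
* §2 **`lapE_chart`**: V1's `lapE c` IS `c²·perLapT` read through the chart.
* §3 **`inGauge_chart_iff`/`chart_mem_ker_QpE_iff`**: `λ ∘ toBox ∈ N(Q′)` of `domT hN D hk` (V1's `InGauge`: vanishing averages over the blocks
  `B^j(y)`, `y ∈ Λ_j`) IFF p21's block average `QB D.toDomains λ = 0` — through `lamSite_domT_iff` (`y^j(x) ∈ Λ_j ⟺ lev x = j`) and the block
  bijection `sum_block_chart`.
* §4 **`mlOpT_mulVec_of_QB_eq_zero`**: on `N(Q′)` the averaging part of `Δ′_a` vanishes, `Δ′_aλ = −Δ^{per}λ` (*"Of course Q′λ = 0 … Δλ = Δ′_aλ"*).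
* §5 **`RE_chart`**: for every symmetric matrix `Rm` with `Rm f ∈ Δ′_a N(Q′)` and `Rm(Δ′_aλ) = Δ′_aλ` (`λ ∈ N(Q′)`): `RE (domT hN D hk) c f x =
  (Rm (f ∘ chart⁻¹))(toBox x)` — V1's `R` (the abstract orthogonal projection onto `lapE c″N(Q′)`) IS p21's matrix, by the uniqueness of orthogonal
  projections (`Submodule.eq_starProjection_of_mem_of_inner_eq_zero`); `RE_single` (entries).
* §6 **`Dg_single`**: the bond kernel of `∂(1 − R)∂*`: `Dg(b, b′) = c²·((S_μ − 1)(1 − Rm)(S_ν − 1)ᵀ)(toBox b₋, toBox b′₋)` (`S_μ = shiftMat (unitVec μ)`).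
* §7 **`hasMajorant_Dg_chart`**: an entry bound `|((S_μ − 1)(1 − Rm)(S_ν − 1)ᵀ)(z, z′)| ≤ C·len(y)^{−2}·W(y′)^{−1}·e^{−δd_T(y,y′)}` (the shape of (2.88) in
  lattice units, `W(y′) = (L^{j′})^{d+1}`) gives `HasMajorant (g := geomT D) (blkV1 hN D) Dg (c²(d+1)C·len(y)^{−2}·e^{−δd_T(y,y′)})` — the `hDg` slot.
THEOREMS ONLY (no `def`, no `def … : Prop`, no new hypothesis-fact); standard axioms; imports BY NAME, restating nothing.

HONEST SCOPE / DIVERGENCES. (1) Lattice units on p21's side (fine spacing `1`), V1 fine factor `c` on r03's side: the dictionary carries the explicit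
`c²`; print's `η = L^{−k}` normalisation is the consumer's ((d5-b) runs the global side with one `c′`). (2) `Rm` is abstract here: the instantiation
with p21's torus `R = 1 − G′Q′*(Q′G′²Q′*)⁻¹Q′G′` and the discharge of the §7 entry bound from their torus (2.88) is a separate (short) file once
`B6Ineq288MultiLevelTorus` lands. (3) The projection characterisation uses symmetry + range + fixing only (idempotency follows); weights `a_j` enter
only through `mlOpT` in the hypotheses and drop out on `N(Q′)` (§4) — `R` does not depend on them, as print's definition (an orthogonal projection
onto `ΔN(Q′)`) says. (4) Nothing here is the (2.88) estimate itself.  NOT summit progress.  Unit `lit-balaban-p22` (gen 19), 2026-08-23.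
-/

noncomputable section

open scoped BigOperators InnerProductSpace Matrix
open Finset

namespace Literature.MathematicalPhysics.QuantumFieldTheory.Balaban1983to89.B6ScalarChartV1

open B4Reflection242 (boxDom mem_boxDom blk avgK)
open B5Eq118OneStroke (iterBlockOf iterBlock mem_iterBlock card_iterBlock siteAvgIter_eq_blockSum)
open B6LowerBound2153Torus (rep)
open B5Eq117TorusCarriers (Mk)
open B6MultiLevelBoxOperator (Domains N0 levC)
open B6MultiLevelTorusOperator (TDomains tshift tshift_val twrap unitVec shiftMat shiftMat_mulVec perLapT perLapT_mulVec mlOpT mlOpT_apply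
  tshift_tshift tshift_zero)
open B6Geom246MultiLevelBox (bset blkOf blkOf_val exists_blkOf_eq blkOf_eq_iff_blk)
open B6Geom246MultiLevelTorus (geomT)
open B6Ineq268MultiLevelBox (W W_pos W_eq QB QB_apply card_blkOf_le)
open B6RandomWalk (HasMajorant BlockSupp)
open B6Ineq2133TwoScaleV1 (onFun onFun_apply)
open B6SectAOperatorsV1 (ScalarSpace dE dsE lapE QpE RE KE mem_ker_QpE_iff lapE_apply dE_apply dsE_apply RE_apply inner_eq_sum)
open B6SectADomainsV1
open B6GlobalChartV1 (PV toBox toBox_apply toBox_injective boxEquiv boxEquiv_apply blk_toBox blkV1 domT iterBlockOf_mem_domT_iff domT_Om_one)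
open BalabanImbrieJaffe1984to88.BIJ85AxialPropagator411 (BondSpace)

variable {d ℓ : ℕ} {m K : ℕ} {hd : 1 ≤ d + 1} {hL : Odd (ℓ + 1) ∧ 1 < ℓ + 1}
variable {Mh k R : ℕ} {P' : Fin (d + 1) → ℕ}

/-! ## §1  The identity chart and the lattice translations -/

section Chart

variable (hN : ∀ μ, N0 ℓ Mh k P' μ = (PV d ℓ m K hd hL).sitesPerDir 0)

/-- **`toBox (x + e_μ) = σ_{e_μ}(toBox x)`**: the chart intertwines the V1 translation `Site.shift` with p21's torus translation `tshift` (both add `1`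
to the `μ`-th label modulo the period). [cite: Balaban1984PropagatorsII, (2.1) p.224; Balaban1983RegularityDecay, p.572 (periodic conditions), dictionary] -/
theorem toBox_shift (x : Site (PV d ℓ m K hd hL) 0) (μ : Fin (d + 1)) :
    toBox hN (x.shift μ) = tshift (N0 ℓ Mh k P') (unitVec μ) (toBox hN x) := by
  apply Subtype.ext
  funext ν
  rw [tshift_val]
  simp only [toBox_apply, twrap, unitVec, Pi.add_apply]
  by_cases hν : ν = μ
  · subst hν
    rw [Pi.single_eq_same]
    show ((((Function.update x ν (x ν + 1)) ν).val : ℕ) : ℤ) = _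
    rw [Function.update_self, ZMod.val_add, ZMod.val_one_eq_one_mod, Nat.add_mod_mod, Int.natCast_mod, hN ν]
    push_cast
    rfl
  · rw [Pi.single_eq_of_ne hν, add_zero]
    show ((((Function.update x μ (x μ + 1)) ν).val : ℕ) : ℤ) = _
    rw [Function.update_of_ne hν]
    have h0 : (0 : ℤ) ≤ ((x ν).val : ℤ) := Nat.cast_nonneg _
    have h1 : ((x ν).val : ℤ) < (N0 ℓ Mh k P' ν : ℤ) := by rw [hN ν]; exact_mod_cast ZMod.val_lt (x ν)
    exact (Int.emod_eq_of_lt h0 h1).symm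

/-- **`toBox (x − e_μ) = σ_{−e_μ}(toBox x)`**. [cite: Balaban1984PropagatorsII, (2.1) p.224; Balaban1983RegularityDecay, p.572, dictionary] -/
theorem toBox_unshift (x : Site (PV d ℓ m K hd hL) 0) (μ : Fin (d + 1)) :
    toBox hN (x.unshift μ) = tshift (N0 ℓ Mh k P') (-unitVec μ) (toBox hN x) := by
  have h := toBox_shift hN (x.unshift μ) μ
  rw [B10StarCount.shift_unshift] at h
  rw [h, tshift_tshift, add_neg_cancel, tshift_zero]

/-- the inverse chart undoes the chart. [cite: Balaban1984PropagatorsII, (2.1) p.224, dictionary] -/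
theorem boxEquiv_symm_toBox (x : Site (PV d ℓ m K hd hL) 0) : (boxEquiv hN).symm (toBox hN x) = x := by
  rw [← boxEquiv_apply hN x, Equiv.symm_apply_apply]

/-- the chart undoes the inverse chart. [cite: Balaban1984PropagatorsII, (2.1) p.224, dictionary] -/
theorem toBox_boxEquiv_symm (z : ↥(boxDom (N0 ℓ Mh k P'))) : toBox hN ((boxEquiv hN).symm z) = z := by
  rw [← boxEquiv_apply hN, Equiv.apply_symm_apply]

/-- a sum over the V1 torus is a sum over the fundamental box. [cite: Balaban1984PropagatorsII, (2.1) p.224, dictionary] -/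
theorem sum_toBox {α : Type*} [AddCommMonoid α] (F : ↥(boxDom (N0 ℓ Mh k P')) → α) :
    ∑ x : Site (PV d ℓ m K hd hL) 0, F (toBox hN x) = ∑ z, F z :=
  Equiv.sum_comp (boxEquiv hN) F

end Chart

/-! ## §2  The scalar Laplacian through the chart -/

section Laplacian

variable (hN : ∀ μ, N0 ℓ Mh k P' μ = (PV d ℓ m K hd hL).sitesPerDir 0)

/-- **V1's `lapE c` IS `c²·(−Δ^{per})` OF p21 READ THROUGH THE CHART**: `(lapE c (λ∘toBox))(x) = c²·(perLapT λ)(toBox x)` — both are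
`Σ_μ(2λ(x) − λ(x + e_μ) − λ(x − e_μ))` with periodic neighbours. [cite: Balaban1984PropagatorsII, (2.13) p.225 («Δ … on T_η»); Balaban1984PropagatorsI, (1.21) p.21] -/
theorem lapE_chart (c : ℝ) (g : ↥(boxDom (N0 ℓ Mh k P')) → ℝ) (x : Site (PV d ℓ m K hd hL) 0) :
    lapE c (WithLp.toLp 2 fun x' : Site (PV d ℓ m K hd hL) 0 => g (toBox hN x')) x = c ^ 2 * (perLapT (N0 ℓ Mh k P') *ᵥ g) (toBox hN x) := by
  rw [lapE_apply, perLapT_mulVec, Finset.mul_sum]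
  unfold LatticeFieldCalculus.laplace
  refine Finset.sum_congr rfl fun μ _ => ?_
  simp only [smul_eq_mul]
  rw [toBox_shift hN x μ, toBox_unshift hN x μ]
  ring

end Laplacian

/-! ## §3  The gauge space `N(Q′)` through the chart -/

section Gauge

variable (hN : ∀ μ, N0 ℓ Mh k P' μ = (PV d ℓ m K hd hL).sitesPerDir 0) (D : TDomains d ℓ Mh k P' R) (hk : k ≤ m + K)

/-- the label map of `T^{(j)}` is injective. [folklore] -/
private theorem rep_injective (j : ℕ) : Function.Injective (rep (Mk (PV d ℓ m K hd hL) j) : Site (PV d ℓ m K hd hL) j → Fin (d + 1) → ℤ) := by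
  intro y y' h
  funext μ
  have hμ := congrFun h μ
  simp only [rep, Nat.cast_inj] at hμ
  exact ZMod.val_injective _ hμ

/-- **same `j`-block ⟺ same `L^j`-label of the chart points** (`blk_toBox`). [cite: Balaban1984PropagatorsI, (1.18) p.20; Balaban1984PropagatorsII, (2.1) p.224, dictionary] -/
theorem iterBlockOf_eq_iff_blk {j : ℕ} (hj : j ≤ m + K) (x x' : Site (PV d ℓ m K hd hL) 0) :
    iterBlockOf j x' = iterBlockOf j x ↔
      blk ((ℓ + 1) ^ j) (toBox hN x' : Fin (d + 1) → ℤ) = blk ((ℓ + 1) ^ j) (toBox hN x : Fin (d + 1) → ℤ) := by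
  rw [blk_toBox hN hj x', blk_toBox hN hj x]
  exact ⟨fun h => by rw [h], fun h => rep_injective j h⟩

include hk in
/-- **same block of `𝔅` ⟺ same V1 block at the level of the site**: `blkOf (toBox x′) = blkOf (toBox x) ⟺ y^{lev x}(x′) = y^{lev x}(x)`.
[cite: Balaban1984PropagatorsII, (2.45) p.231 («𝔅 = ⋃_j Λ_j»), (2.1) p.224, dictionary] -/
theorem blkOf_toBox_eq_iff (x x' : Site (PV d ℓ m K hd hL) 0) :
    blkOf D.toDomains (toBox hN x') = blkOf D.toDomains (toBox hN x) ↔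
      iterBlockOf (D.lev (toBox hN x : Fin (d + 1) → ℤ)) x' = iterBlockOf (D.lev (toBox hN x : Fin (d + 1) → ℤ)) x := by
  rw [blkOf_eq_iff_blk, iterBlockOf_eq_iff_blk hN ((D.lev_le _).trans hk)]
  simp only [blkOf_val, TDomains.toDomains_lev]

include hk in
/-- **THE BLOCK SUM THROUGH THE CHART**: the sum of `λ∘toBox` over the V1 block `B^{lev x}(y^{lev x}(x))` is the sum of `λ` over p21's block
`blkOf (toBox x)` of `𝔅`. [cite: Balaban1984PropagatorsII, (2.14) p.225 («(Q′_jλ)(y)»), dictionary] -/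
theorem sum_block_chart (g : ↥(boxDom (N0 ℓ Mh k P')) → ℝ) (x : Site (PV d ℓ m K hd hL) 0) :
    ∑ x' ∈ iterBlock (D.lev (toBox hN x : Fin (d + 1) → ℤ)) (iterBlockOf (D.lev (toBox hN x : Fin (d + 1) → ℤ)) x), g (toBox hN x') =
      ∑ z ∈ Finset.univ.filter (fun z => blkOf D.toDomains z = blkOf D.toDomains (toBox hN x)), g z := by
  classical
  rw [Finset.sum_filter]
  have e1 : ∑ x' ∈ iterBlock (D.lev (toBox hN x : Fin (d + 1) → ℤ)) (iterBlockOf (D.lev (toBox hN x : Fin (d + 1) → ℤ)) x), g (toBox hN x') =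
      ∑ x' : Site (PV d ℓ m K hd hL) 0, if blkOf D.toDomains (toBox hN x') = blkOf D.toDomains (toBox hN x) then g (toBox hN x') else 0 := by
    rw [← Finset.sum_filter]
    refine Finset.sum_congr ?_ fun _ _ => rfl
    ext x'
    rw [mem_iterBlock, Finset.mem_filter, blkOf_toBox_eq_iff hN D hk]
    simp
  rw [e1]
  exact sum_toBox hN (fun z => if blkOf D.toDomains z = blkOf D.toDomains (toBox hN x) then g z else 0)

/-- every site of `T^{(j)}` is the block point of some fine site (blocks are non-empty). [cite: Balaban1984PropagatorsI, (1.18) p.20] -/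
theorem exists_iterBlockOf_eq {j : ℕ} (hj : j ≤ m + K) (y : Site (PV d ℓ m K hd hL) j) : ∃ x : Site (PV d ℓ m K hd hL) 0, iterBlockOf j x = y := by
  have hcard := card_iterBlock (P := PV d ℓ m K hd hL) j hj y
  have hpos : 0 < (iterBlock j y).card := by
    rw [hcard]
    exact pow_pos (pow_pos (by show 0 < ℓ + 1; omega) _) _
  obtain ⟨x, hx⟩ := Finset.card_pos.1 hpos
  exact ⟨x, (mem_iterBlock j y x).1 hx⟩

include hk in
/-- **`y^j(x) ∈ Λ_j ⟺ lev x = j`**: the V1 index condition `LamSite j` of `domT` (block in `Ω_j`, next block not in `Ω_{j+1}`) at the block of a fine site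
is p21's territory condition `lev (toBox x) = j` — by (2.1) (`iterBlockOf_mem_domT_iff`; `Ω₁ = T_η`, `Ω_j = ∅` above `k`).
[cite: Balaban1984PropagatorsII, (2.3)–(2.4) p.224 («Λ_j = Ω_j^{(j)} ∖ B^j(Ω_{j+1})»)] -/
theorem lamSite_domT_iff (j : ℕ) (x : Site (PV d ℓ m K hd hL) 0) :
    (domT hN D hk).LamSite j (iterBlockOf j x) ↔ D.lev (toBox hN x : Fin (d + 1) → ℤ) = j := by
  classical
  have h1 := D.one_le_lev (toBox hN x : Fin (d + 1) → ℤ)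
  have h2 := D.lev_le (toBox hN x : Fin (d + 1) → ℤ)
  have hk1 : 1 ≤ k := h1.trans h2
  unfold Domains.LamSite Domains.Deep
  rw [← B5Eq118OneStroke.iterBlockOf_succ]
  by_cases hj0 : j = 0
  · subst hj0
    rw [domT_Om_one hN D hk hk1]
    simp only [Finset.mem_univ, not_true_eq_false, and_false, false_iff]
    omega
  have hj1 : 1 ≤ j := Nat.one_le_iff_ne_zero.2 hj0
  by_cases hjk : j ≤ k
  · rw [iterBlockOf_mem_domT_iff hN D hk hj1 hjk]
    by_cases hjk' : j + 1 ≤ k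
    · rw [iterBlockOf_mem_domT_iff hN D hk (by omega) hjk']
      omega
    · have hempty : (domT hN D hk).Om (j + 1) = ∅ := (domT hN D hk).Om_eq_empty (by show k < j + 1; omega)
      rw [hempty]
      simp only [Finset.notMem_empty, not_false_eq_true, and_true]
      omega
  · have hempty : (domT hN D hk).Om j = ∅ := (domT hN D hk).Om_eq_empty (by show k < j; omega)
    rw [hempty]
    simp only [Finset.notMem_empty, false_and, false_iff]
    omega

include hk in
/-- **THE GAUGE SPACE THROUGH THE CHART**: `λ∘toBox ∈ N(Q′)` of the V1 domain datum `domT hN D hk` (every block average over `B^j(y)`, `y ∈ Λ_j`,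
vanishes) IFF p21's block average vanishes, `QB D.toDomains λ = 0` (every block of `𝔅`). [cite: Balaban1984PropagatorsII, (2.10) p.225 («N(Q′) = {λ : λ satisfies (2.7)}»), (2.14) p.225] -/
theorem inGauge_chart_iff (g : ↥(boxDom (N0 ℓ Mh k P')) → ℝ) :
    (domT hN D hk).InGauge (fun x : Site (PV d ℓ m K hd hL) 0 => g (toBox hN x)) ↔ QB D.toDomains g = 0 := by
  classical
  constructor
  · intro h
    funext s
    obtain ⟨z, rfl⟩ := exists_blkOf_eq D.toDomains s
    set x : Site (PV d ℓ m K hd hL) 0 := (boxEquiv hN).symm z with hxdef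
    have hz : toBox hN x = z := toBox_boxEquiv_symm hN z
    rw [← hz]
    have hjle : D.lev (toBox hN x : Fin (d + 1) → ℤ) ≤ m + K := (D.lev_le _).trans hk
    have hlam : (domT hN D hk).LamSite (D.lev (toBox hN x : Fin (d + 1) → ℤ)) (iterBlockOf (D.lev (toBox hN x : Fin (d + 1) → ℤ)) x) :=
      (lamSite_domT_iff hN D hk _ x).2 rfl
    have h0 := h _ _ hlam
    rw [siteAvgIter_eq_blockSum _ hjle, smul_eq_mul, mul_eq_zero] at h0
    have hsum : ∑ x' ∈ iterBlock (D.lev (toBox hN x : Fin (d + 1) → ℤ)) (iterBlockOf (D.lev (toBox hN x : Fin (d + 1) → ℤ)) x), g (toBox hN x') = 0 := by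
      rcases h0 with h0 | h0
      · exfalso
        exact (inv_ne_zero (pow_ne_zero _ (pow_ne_zero _ (by exact_mod_cast (show ℓ + 1 ≠ 0 by omega))))) h0
      · exact h0
    rw [sum_block_chart hN D hk g x] at hsum
    rw [QB_apply, hsum, mul_zero, Pi.zero_apply]
  · intro h j y hy
    by_cases hj : j ≤ m + K
    · obtain ⟨x, rfl⟩ := exists_iterBlockOf_eq (d := d) (ℓ := ℓ) (hd := hd) (hL := hL) hj y
      have hlev : D.lev (toBox hN x : Fin (d + 1) → ℤ) = j := (lamSite_domT_iff hN D hk j x).1 hy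
      subst hlev
      rw [siteAvgIter_eq_blockSum _ hj, sum_block_chart hN D hk g x]
      have hQ := congrFun h (blkOf D.toDomains (toBox hN x))
      rw [QB_apply, Pi.zero_apply, mul_eq_zero] at hQ
      rcases hQ with hQ | hQ
      · exact absurd hQ (inv_ne_zero (W_pos _ _).ne')
      · rw [hQ, smul_zero]
    · exfalso
      have := (domT hN D hk).le_of_lamSite hy
      have hkk : (domT hN D hk).k = k := rfl
      omega

include hk in
/-- the same in `ℓ²` form: `toLp (λ∘toBox) ∈ ker Q′` of `domT` IFF `QB λ = 0`. [cite: Balaban1984PropagatorsII, (2.10) p.225, (2.14) p.225] -/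
theorem chart_mem_ker_QpE_iff (g : ↥(boxDom (N0 ℓ Mh k P')) → ℝ) :
    (WithLp.toLp 2 fun x : Site (PV d ℓ m K hd hL) 0 => g (toBox hN x)) ∈ LinearMap.ker (QpE (domT hN D hk)) ↔ QB D.toDomains g = 0 := by
  rw [mem_ker_QpE_iff, WithLp.ofLp_toLp]
  exact inGauge_chart_iff hN D hk g

end Gauge

/-! ## §4  On `N(Q′)` the averaging part of `Δ′_a` vanishes -/

section Averaging

variable (D : TDomains d ℓ Mh k P' R)

/-- **`Δ′_aλ = −Δ^{per}λ` FOR `λ ∈ N(Q′)`** (*"Of course Q′λ = 0 [hence] Δλ = Δ′_aλ"*, p. 225): the level-`j` averaging term of p21's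
`mlOpT` at a site `x` is `levC_{lev x}` times the sum of `λ` over the block of `𝔅` containing `x`, which is `W·(Q′λ)(y(x)) = 0`.
[cite: Balaban1984PropagatorsII, (2.13)–(2.17) p.225] -/
theorem mlOpT_mulVec_of_QB_eq_zero (a : ℕ → ℝ) {g : ↥(boxDom (N0 ℓ Mh k P')) → ℝ} (hg : QB D.toDomains g = 0) :
    mlOpT (N0 ℓ Mh k P') ℓ k D.lev a *ᵥ g = perLapT (N0 ℓ Mh k P') *ᵥ g := by
  classical
  funext x
  simp only [Matrix.mulVec, dotProduct]
  simp_rw [mlOpT_apply D rfl a x, add_mul]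
  rw [Finset.sum_add_distrib, add_eq_left]
  -- the averaging row at `x`: `levC·Σ_{y ∈ block of x} λ(y)`
  have hrow : ∀ y : ↥(boxDom (N0 ℓ Mh k P')),
      avgK (levC d ℓ a (D.lev x.1)) ((ℓ + 1) ^ D.lev x.1) x.1 y.1 * g y =
        if blkOf D.toDomains y = blkOf D.toDomains x then levC d ℓ a (D.lev x.1) * g y else 0 := by
    intro y
    unfold avgK
    have hiff : blk ((ℓ + 1) ^ D.lev x.1) y.1 = blk ((ℓ + 1) ^ D.lev x.1) x.1 ↔ blkOf D.toDomains y = blkOf D.toDomains x := by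
      rw [blkOf_eq_iff_blk]
      simp only [blkOf_val, TDomains.toDomains_lev]
    by_cases hb : blkOf D.toDomains y = blkOf D.toDomains x
    · rw [if_pos (hiff.2 hb), if_pos hb]
    · rw [if_neg (fun h' => hb (hiff.1 h')), if_neg hb, zero_mul]
  simp_rw [hrow]
  rw [← Finset.sum_filter, ← Finset.mul_sum]
  have hQ := congrFun hg (blkOf D.toDomains x)
  rw [QB_apply, Pi.zero_apply, mul_eq_zero] at hQ
  rcases hQ with hQ | hQ
  · exact absurd hQ (inv_ne_zero (W_pos _ _).ne')
  · rw [hQ, mul_zero]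

end Averaging

/-! ## §5  V1's `R` IS the torus orthogonal projection onto `ΔN(Q′)`, read through the chart -/

section Projection

variable (hN : ∀ μ, N0 ℓ Mh k P' μ = (PV d ℓ m K hd hL).sitesPerDir 0) (D : TDomains d ℓ Mh k P' R) (hk : k ≤ m + K)

include hk in
/-- **`R` OF (2.17) THROUGH THE CHART.**  Let `Rm` be a symmetric matrix on the fundamental box whose range lies in `(−Δ^{per})N(Q′)` and which fixes
`(−Δ^{per})N(Q′)` pointwise (`N(Q′)` = p21's `QB λ = 0`).  Then V1's `R = RE (domT hN D hk) c` — by definition THE orthogonal projection of `ℓ²(T_η)` onto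
`lapE c″N(Q′)` (*"let R be an orthogonal projection in the space L²(T_η) onto the subspace ΔN(Q′)"*) — is `Rm` read through the chart:
`(Rf)(x) = (Rm(f∘chart⁻¹))(toBox x)` for every `c ≠ 0`.  (Uniqueness of the orthogonal projection: `Rm f ∈ K` and `f − Rm f ⊥ K` by symmetry + fixing.)
[cite: Balaban1984PropagatorsII, (2.13)–(2.17) p.225] -/
theorem RE_chart {c : ℝ} (hc : c ≠ 0) (Rm : Matrix ↥(boxDom (N0 ℓ Mh k P')) ↥(boxDom (N0 ℓ Mh k P')) ℝ) (hs : Rm.IsSymm)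
    (hr : ∀ f : ↥(boxDom (N0 ℓ Mh k P')) → ℝ, ∃ lam : ↥(boxDom (N0 ℓ Mh k P')) → ℝ,
      QB D.toDomains lam = 0 ∧ Rm *ᵥ f = perLapT (N0 ℓ Mh k P') *ᵥ lam)
    (hf : ∀ lam : ↥(boxDom (N0 ℓ Mh k P')) → ℝ, QB D.toDomains lam = 0 →
      Rm *ᵥ (perLapT (N0 ℓ Mh k P') *ᵥ lam) = perLapT (N0 ℓ Mh k P') *ᵥ lam)
    (f : ScalarSpace (PV d ℓ m K hd hL)) (x : Site (PV d ℓ m K hd hL) 0) :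
    RE (domT hN D hk) c f x = (Rm *ᵥ fun z => f ((boxEquiv hN).symm z)) (toBox hN x) := by
  classical
  obtain ⟨ft, hft⟩ : ∃ ft : ↥(boxDom (N0 ℓ Mh k P')) → ℝ, ft = fun z => f ((boxEquiv hN).symm z) := ⟨_, rfl⟩
  obtain ⟨v, hv⟩ : ∃ v : ScalarSpace (PV d ℓ m K hd hL),
      v = WithLp.toLp 2 (fun x' : Site (PV d ℓ m K hd hL) 0 => (Rm *ᵥ ft) (toBox hN x')) := ⟨_, rfl⟩
  have hftx : ∀ x' : Site (PV d ℓ m K hd hL) 0, ft (toBox hN x') = f x' := fun x' => by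
    rw [hft]
    exact congrArg f (boxEquiv_symm_toBox hN x')
  suffices h : (KE (domT hN D hk) c).starProjection f = v by
    rw [RE_apply, h, hv, ← hft]
  apply Submodule.eq_starProjection_of_mem_of_inner_eq_zero
  · -- `v ∈ K`: `Rm ft = −Δ^{per}λ`, `λ ∈ N(Q′)`, and `lapE c (λ∘toBox) = c²(−Δ^{per}λ)∘toBox`
    obtain ⟨lam, hlam0, hRf⟩ := hr ft
    have hn : (WithLp.toLp 2 fun x' : Site (PV d ℓ m K hd hL) 0 => lam (toBox hN x')) ∈ LinearMap.ker (QpE (domT hN D hk)) :=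
      (chart_mem_ker_QpE_iff hN D hk lam).2 hlam0
    have hv' : v = (c ^ 2)⁻¹ • lapE c (WithLp.toLp 2 fun x' : Site (PV d ℓ m K hd hL) 0 => lam (toBox hN x')) := by
      rw [hv]
      ext x'
      rw [WithLp.ofLp_smul, Pi.smul_apply, lapE_chart hN c lam x', smul_eq_mul, WithLp.ofLp_toLp, hRf]
      field_simp
    rw [hv']
    exact Submodule.smul_mem _ _ (Submodule.mem_map_of_mem hn)
  · -- `f − v ⊥ K`
    intro w hw
    obtain ⟨n, hn, rfl⟩ := Submodule.mem_map.1 hw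
    obtain ⟨lam, hlam⟩ : ∃ lam : ↥(boxDom (N0 ℓ Mh k P')) → ℝ, lam = fun z => n ((boxEquiv hN).symm z) := ⟨_, rfl⟩
    have hnlam : n = WithLp.toLp 2 (fun x' : Site (PV d ℓ m K hd hL) 0 => lam (toBox hN x')) := by
      ext x'
      rw [WithLp.ofLp_toLp, hlam]
      exact (congrArg n (boxEquiv_symm_toBox hN x')).symm
    have hlam0 : QB D.toDomains lam = 0 := (chart_mem_ker_QpE_iff hN D hk lam).1 (hnlam ▸ hn)
    have hq := hf lam hlam0
    rw [inner_eq_sum]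
    have hterm : ∀ x' : Site (PV d ℓ m K hd hL) 0, (f - v) x' * (lapE c n) x' =
        (fun z => c ^ 2 * ((ft z - (Rm *ᵥ ft) z) * (perLapT (N0 ℓ Mh k P') *ᵥ lam) z)) (toBox hN x') := by
      intro x'
      rw [hnlam, lapE_chart hN c lam x', hv, WithLp.ofLp_sub, Pi.sub_apply, WithLp.ofLp_toLp, ← hftx x']
      ring
    rw [Finset.sum_congr rfl (fun x' _ => hterm x'),
      sum_toBox hN (fun z => c ^ 2 * ((ft z - (Rm *ᵥ ft) z) * (perLapT (N0 ℓ Mh k P') *ᵥ lam) z)), ← Finset.mul_sum]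
    have h1 : (Rm *ᵥ ft) ⬝ᵥ (perLapT (N0 ℓ Mh k P') *ᵥ lam) = ft ⬝ᵥ (perLapT (N0 ℓ Mh k P') *ᵥ lam) := by
      rw [dotProduct_comm (Rm *ᵥ ft) (perLapT (N0 ℓ Mh k P') *ᵥ lam), Matrix.dotProduct_mulVec (perLapT (N0 ℓ Mh k P') *ᵥ lam) Rm ft,
        ← Matrix.mulVec_transpose Rm (perLapT (N0 ℓ Mh k P') *ᵥ lam), hs.eq, hq, dotProduct_comm]
    have key : (ft - Rm *ᵥ ft) ⬝ᵥ (perLapT (N0 ℓ Mh k P') *ᵥ lam) = 0 := by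
      rw [sub_dotProduct, h1, sub_self]
    unfold dotProduct at key
    simp only [Pi.sub_apply] at key
    rw [key, mul_zero]

include hk in
/-- **ENTRIES**: `(R e_v)(u) = Rm(toBox u, toBox v)` — the kernel of V1's `R` is p21's matrix. [cite: Balaban1984PropagatorsII, (2.17) p.225] -/
theorem RE_single {c : ℝ} (hc : c ≠ 0) (Rm : Matrix ↥(boxDom (N0 ℓ Mh k P')) ↥(boxDom (N0 ℓ Mh k P')) ℝ) (hs : Rm.IsSymm)
    (hr : ∀ f : ↥(boxDom (N0 ℓ Mh k P')) → ℝ, ∃ lam : ↥(boxDom (N0 ℓ Mh k P')) → ℝ,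
      QB D.toDomains lam = 0 ∧ Rm *ᵥ f = perLapT (N0 ℓ Mh k P') *ᵥ lam)
    (hf : ∀ lam : ↥(boxDom (N0 ℓ Mh k P')) → ℝ, QB D.toDomains lam = 0 →
      Rm *ᵥ (perLapT (N0 ℓ Mh k P') *ᵥ lam) = perLapT (N0 ℓ Mh k P') *ᵥ lam)
    (u v : Site (PV d ℓ m K hd hL) 0) :
    RE (domT hN D hk) c (EuclideanSpace.single v (1 : ℝ)) u = Rm (toBox hN u) (toBox hN v) := by
  classical
  rw [RE_chart hN D hk hc Rm hs hr hf]
  simp only [Matrix.mulVec, dotProduct, PiLp.single_apply]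
  rw [Finset.sum_eq_single (toBox hN v)]
  · rw [boxEquiv_symm_toBox, if_pos rfl, mul_one]
  · intro z _ hz
    rw [if_neg, mul_zero]
    intro h
    apply hz
    rw [← h, toBox_boxEquiv_symm]
  · intro h; exact absurd (Finset.mem_univ _) h

/-- the same hypotheses with p21's `Δ′_a = mlOpT` in place of `−Δ^{per}` (on `N(Q′)` they agree, §4) — the literal shape of p21's
`rM_mulVec_eq`/`rM_mulVec_dP_of_ker`. [cite: Balaban1984PropagatorsII, (2.16)–(2.17) p.225] -/
theorem range_fix_of_mlOpT (a : ℕ → ℝ) (Rm : Matrix ↥(boxDom (N0 ℓ Mh k P')) ↥(boxDom (N0 ℓ Mh k P')) ℝ)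
    (hr : ∀ f : ↥(boxDom (N0 ℓ Mh k P')) → ℝ, ∃ lam : ↥(boxDom (N0 ℓ Mh k P')) → ℝ,
      QB D.toDomains lam = 0 ∧ Rm *ᵥ f = mlOpT (N0 ℓ Mh k P') ℓ k D.lev a *ᵥ lam)
    (hf : ∀ lam : ↥(boxDom (N0 ℓ Mh k P')) → ℝ, QB D.toDomains lam = 0 →
      Rm *ᵥ (mlOpT (N0 ℓ Mh k P') ℓ k D.lev a *ᵥ lam) = mlOpT (N0 ℓ Mh k P') ℓ k D.lev a *ᵥ lam) :
    (∀ f : ↥(boxDom (N0 ℓ Mh k P')) → ℝ, ∃ lam : ↥(boxDom (N0 ℓ Mh k P')) → ℝ,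
        QB D.toDomains lam = 0 ∧ Rm *ᵥ f = perLapT (N0 ℓ Mh k P') *ᵥ lam) ∧
      (∀ lam : ↥(boxDom (N0 ℓ Mh k P')) → ℝ, QB D.toDomains lam = 0 →
        Rm *ᵥ (perLapT (N0 ℓ Mh k P') *ᵥ lam) = perLapT (N0 ℓ Mh k P') *ᵥ lam) := by
  refine ⟨fun f => ?_, fun lam hlam => ?_⟩
  · obtain ⟨lam, hlam, h⟩ := hr f
    exact ⟨lam, hlam, by rw [h, mlOpT_mulVec_of_QB_eq_zero D a hlam]⟩
  · have h := hf lam hlam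
    rwa [mlOpT_mulVec_of_QB_eq_zero D a hlam] at h

end Projection

/-! ## §6  The bond kernel of `∂P∂* = ∂(1 − R)∂*` through the chart -/

section Kernel

variable {N : Fin (d + 1) → ℕ}

/-- `(S_v Q)(z, z′) = Q(σ_v z, z′)`. [folklore] -/
private theorem shiftMat_mul_apply (v : Fin (d + 1) → ℤ) (Q : Matrix ↥(boxDom N) ↥(boxDom N) ℝ) (z z' : ↥(boxDom N)) :
    (shiftMat N v * Q) z z' = Q (tshift N v z) z' := by
  classical
  rw [Matrix.mul_apply]
  simp only [shiftMat, ite_mul, one_mul, zero_mul, Finset.sum_ite_eq', Finset.mem_univ, if_true]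

/-- `(Q S_vᵀ)(z, z′) = Q(z, σ_v z′)`. [folklore] -/
private theorem mul_shiftMat_transpose_apply (v : Fin (d + 1) → ℤ) (Q : Matrix ↥(boxDom N) ↥(boxDom N) ℝ) (z z' : ↥(boxDom N)) :
    (Q * (shiftMat N v)ᵀ) z z' = Q z (tshift N v z') := by
  classical
  rw [Matrix.mul_apply]
  simp only [Matrix.transpose_apply, shiftMat, mul_ite, mul_one, mul_zero, Finset.sum_ite_eq', Finset.mem_univ, if_true]

/-- **the four-point formula**: `((S_v − 1)Q(S_{v′} − 1)ᵀ)(z, z′) = Q(σ_vz, σ_{v′}z′) − Q(σ_vz, z′) − Q(z, σ_{v′}z′) + Q(z, z′)`.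
[cite: Balaban1984PropagatorsII, (2.88) p.238 («(∂_μP∂_ν*)(x, x′)»), dictionary] -/
theorem sandwich_apply (v v' : Fin (d + 1) → ℤ) (Q : Matrix ↥(boxDom N) ↥(boxDom N) ℝ) (z z' : ↥(boxDom N)) :
    ((shiftMat N v - 1) * Q * (shiftMat N v' - 1)ᵀ : Matrix ↥(boxDom N) ↥(boxDom N) ℝ) z z' =
      Q (tshift N v z) (tshift N v' z') - Q (tshift N v z) z' - Q z (tshift N v' z') + Q z z' := by
  rw [Matrix.transpose_sub, Matrix.transpose_one, Matrix.mul_sub, Matrix.mul_one, Matrix.sub_apply,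
    mul_shiftMat_transpose_apply, Matrix.sub_mul, Matrix.one_mul, Matrix.sub_apply, Matrix.sub_apply, shiftMat_mul_apply,
    shiftMat_mul_apply]
  ring

variable (hN : ∀ μ, N0 ℓ Mh k P' μ = (PV d ℓ m K hd hL).sitesPerDir 0) (D : TDomains d ℓ Mh k P' R) (hk : k ≤ m + K)

/-- **`∂*e_{b′} = c·(e_{b′₊} − e_{b′₋})`**: the V1 divergence of the unit bond function at `b′ = ⟨x′, ν⟩` is `c(δ_{x′+e_ν} − δ_{x′})`.
[cite: Balaban1984PropagatorsI, (1.21) p.21 («∂* is the divergence operator»)] -/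
theorem dsE_single (c : ℝ) (b' : PBond (PV d ℓ m K hd hL) 0) :
    dsE c (EuclideanSpace.single b' (1 : ℝ)) =
      c • (EuclideanSpace.single (b'.src.shift b'.dir) (1 : ℝ) - EuclideanSpace.single b'.src (1 : ℝ)) := by
  classical
  ext u
  rw [dsE_apply, WithLp.ofLp_smul, WithLp.ofLp_sub, Pi.smul_apply, Pi.sub_apply, PiLp.ofLp_single, PiLp.ofLp_single, PiLp.ofLp_single,
    smul_eq_mul]
  unfold LatticeFieldCalculus.diverg
  rw [Finset.sum_eq_single b'.dir]
  · have e1 : Pi.single (M := fun _ : PBond (PV d ℓ m K hd hL) 0 => ℝ) b' (1 : ℝ) ⟨u.unshift b'.dir, b'.dir⟩ =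
        Pi.single (M := fun _ : Site (PV d ℓ m K hd hL) 0 => ℝ) (b'.src.shift b'.dir) (1 : ℝ) u := by
      by_cases h : u = b'.src.shift b'.dir
      · have hb : (⟨u.unshift b'.dir, b'.dir⟩ : PBond (PV d ℓ m K hd hL) 0) = b' := by
          rw [h, B10StarCount.unshift_shift]
        rw [hb, h, Pi.single_eq_same, Pi.single_eq_same]
      · have hb : (⟨u.unshift b'.dir, b'.dir⟩ : PBond (PV d ℓ m K hd hL) 0) ≠ b' := by
          intro hb
          apply h
          have hs : u.unshift b'.dir = b'.src := congrArg PBond.src hb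
          rw [← hs, B10StarCount.shift_unshift]
        rw [Pi.single_eq_of_ne hb, Pi.single_eq_of_ne h]
    have e2 : Pi.single (M := fun _ : PBond (PV d ℓ m K hd hL) 0 => ℝ) b' (1 : ℝ) ⟨u, b'.dir⟩ =
        Pi.single (M := fun _ : Site (PV d ℓ m K hd hL) 0 => ℝ) b'.src (1 : ℝ) u := by
      by_cases h : u = b'.src
      · have hb : (⟨u, b'.dir⟩ : PBond (PV d ℓ m K hd hL) 0) = b' := by rw [h]
        rw [hb, h, Pi.single_eq_same, Pi.single_eq_same]
      · have hb : (⟨u, b'.dir⟩ : PBond (PV d ℓ m K hd hL) 0) ≠ b' := fun hb => h (congrArg PBond.src hb)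
        rw [Pi.single_eq_of_ne hb, Pi.single_eq_of_ne h]
    rw [e1, e2, smul_eq_mul]
  · intro ν _ hν
    have e1 : (⟨u.unshift ν, ν⟩ : PBond (PV d ℓ m K hd hL) 0) ≠ b' := fun h => hν (congrArg PBond.dir h)
    have e2 : (⟨u, ν⟩ : PBond (PV d ℓ m K hd hL) 0) ≠ b' := fun h => hν (congrArg PBond.dir h)
    rw [Pi.single_eq_of_ne e1, Pi.single_eq_of_ne e2, sub_self, smul_zero]
  · intro h; exact absurd (Finset.mem_univ _) h

include hk in
/-- **entries of `1 − R`**: `((1 − R)e_v)(u) = (1 − Rm)(toBox u, toBox v)`. [cite: Balaban1984PropagatorsII, (2.17)–(2.18) p.225 («R = I − P»)] -/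
theorem oneSubRE_single {c : ℝ} (hc : c ≠ 0) (Rm : Matrix ↥(boxDom (N0 ℓ Mh k P')) ↥(boxDom (N0 ℓ Mh k P')) ℝ) (hs : Rm.IsSymm)
    (hr : ∀ f : ↥(boxDom (N0 ℓ Mh k P')) → ℝ, ∃ lam : ↥(boxDom (N0 ℓ Mh k P')) → ℝ,
      QB D.toDomains lam = 0 ∧ Rm *ᵥ f = perLapT (N0 ℓ Mh k P') *ᵥ lam)
    (hf : ∀ lam : ↥(boxDom (N0 ℓ Mh k P')) → ℝ, QB D.toDomains lam = 0 →
      Rm *ᵥ (perLapT (N0 ℓ Mh k P') *ᵥ lam) = perLapT (N0 ℓ Mh k P') *ᵥ lam)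
    (u v : Site (PV d ℓ m K hd hL) 0) :
    ((LinearMap.id - RE (domT hN D hk) c : ScalarSpace (PV d ℓ m K hd hL) →ₗ[ℝ] ScalarSpace (PV d ℓ m K hd hL))
        (EuclideanSpace.single v (1 : ℝ))) u = (1 - Rm) (toBox hN u) (toBox hN v) := by
  classical
  rw [LinearMap.sub_apply, LinearMap.id_apply, WithLp.ofLp_sub, Pi.sub_apply, RE_single hN D hk hc Rm hs hr hf, PiLp.ofLp_single,
    Matrix.sub_apply, Matrix.one_apply]
  congr 1
  by_cases h : u = v
  · subst h; simp
  · rw [Pi.single_eq_of_ne h, if_neg (fun h' => h (toBox_injective hN h'))]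

include hk in
/-- **THE BOND KERNEL OF `∂P∂* = ∂(1 − R)∂*` THROUGH THE CHART**: for bonds `b = ⟨x, μ⟩`, `b′ = ⟨x′, ν⟩` of the V1 torus,
`(∂(1 − R)∂* e_{b′})(b) = c²·((S_μ − 1)(1 − Rm)(S_ν − 1)ᵀ)(toBox x, toBox x′)` — V1's `Dg = onFun (dE c ∘ (1 − RE) ∘ dsE c)` has p21's
`∂_μP∂_ν*` matrix as its kernel (lattice units, factor `c²`). [cite: Balaban1984PropagatorsII, (2.88) p.238, (2.18)–(2.19) p.226] -/
theorem Dg_single {c : ℝ} (hc : c ≠ 0) (Rm : Matrix ↥(boxDom (N0 ℓ Mh k P')) ↥(boxDom (N0 ℓ Mh k P')) ℝ) (hs : Rm.IsSymm)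
    (hr : ∀ f : ↥(boxDom (N0 ℓ Mh k P')) → ℝ, ∃ lam : ↥(boxDom (N0 ℓ Mh k P')) → ℝ,
      QB D.toDomains lam = 0 ∧ Rm *ᵥ f = perLapT (N0 ℓ Mh k P') *ᵥ lam)
    (hf : ∀ lam : ↥(boxDom (N0 ℓ Mh k P')) → ℝ, QB D.toDomains lam = 0 →
      Rm *ᵥ (perLapT (N0 ℓ Mh k P') *ᵥ lam) = perLapT (N0 ℓ Mh k P') *ᵥ lam)
    (b b' : PBond (PV d ℓ m K hd hL) 0) :
    (dE c ∘ₗ (LinearMap.id - RE (domT hN D hk) c) ∘ₗ dsE c) (EuclideanSpace.single b' (1 : ℝ)) b =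
      c ^ 2 * ((shiftMat (N0 ℓ Mh k P') (unitVec b.dir) - 1) * (1 - Rm) * (shiftMat (N0 ℓ Mh k P') (unitVec b'.dir) - 1)ᵀ :
          Matrix ↥(boxDom (N0 ℓ Mh k P')) ↥(boxDom (N0 ℓ Mh k P')) ℝ) (toBox hN b.src) (toBox hN b'.src) := by
  classical
  have hQ : ∀ w z : Site (PV d ℓ m K hd hL) 0,
      ((LinearMap.id - RE (domT hN D hk) c : ScalarSpace (PV d ℓ m K hd hL) →ₗ[ℝ] ScalarSpace (PV d ℓ m K hd hL))
        (EuclideanSpace.single z (1 : ℝ))) w = (1 - Rm) (toBox hN w) (toBox hN z) :=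
    fun w z => oneSubRE_single hN D hk hc Rm hs hr hf w z
  rw [sandwich_apply, LinearMap.comp_apply, LinearMap.comp_apply, dsE_single, map_smul, map_sub, dE_apply]
  unfold LatticeFieldCalculus.grad
  rw [show b.tgt = b.src.shift b.dir from rfl, WithLp.ofLp_smul, WithLp.ofLp_sub, Pi.smul_apply, Pi.smul_apply, Pi.sub_apply, Pi.sub_apply,
    smul_eq_mul, smul_eq_mul, hQ, hQ, hQ, hQ, toBox_shift hN b.src b.dir, toBox_shift hN b'.src b'.dir]
  ring

end Kernel

/-! ## §7  A (2.88)-type entry bound transfers to the block majorant of `Dg` on `geomT` -/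

section Majorant

variable (hN : ∀ μ, N0 ℓ Mh k P' μ = (PV d ℓ m K hd hL).sitesPerDir 0) (D : TDomains d ℓ Mh k P' R) (hk : k ≤ m + K)

/-- the bonds starting in a block of `𝔅`: at most `(d + 1)·W(y′)` of them (`d + 1` directions per site, `card_blkOf_le`).
[cite: Balaban1984PropagatorsII, (2.45) p.231, bookkeeping] -/
theorem card_bonds_blkV1_le (y' : ↥(bset D.toDomains)) :
    (((Finset.univ.filter fun b' : PBond (PV d ℓ m K hd hL) 0 => blkV1 hN D b' = y').card : ℕ) : ℝ) ≤ ((d : ℝ) + 1) * W D.toDomains y' := by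
  classical
  have hinj : Set.InjOn (fun b' : PBond (PV d ℓ m K hd hL) 0 => (toBox hN b'.src, b'.dir))
      ↑(Finset.univ.filter fun b' : PBond (PV d ℓ m K hd hL) 0 => blkV1 hN D b' = y') := by
    intro b₁ _ b₂ _ h
    simp only [Prod.mk.injEq] at h
    obtain ⟨h1, h2⟩ := h
    have hsrc : b₁.src = b₂.src := toBox_injective hN h1
    cases b₁; cases b₂
    simp only at hsrc h2
    subst hsrc; subst h2; rfl
  have hmaps : Set.MapsTo (fun b' : PBond (PV d ℓ m K hd hL) 0 => (toBox hN b'.src, b'.dir))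
      ↑(Finset.univ.filter fun b' : PBond (PV d ℓ m K hd hL) 0 => blkV1 hN D b' = y')
      ↑((Finset.univ.filter fun z : ↥(boxDom (N0 ℓ Mh k P')) => blkOf D.toDomains z = y') ×ˢ (Finset.univ : Finset (Fin (d + 1)))) := by
    intro b' hb'
    have hb'' : blkV1 hN D b' = y' := by simpa using hb'
    simp only [Finset.coe_product, Finset.coe_filter, Finset.coe_univ, Set.mem_prod, Set.mem_setOf_eq, Set.mem_univ, and_true,
      Finset.mem_univ, true_and]
    exact hb''
  have hcard := Finset.card_le_card_of_injOn _ hmaps hinj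
  rw [Finset.card_product, Finset.card_univ, Fintype.card_fin] at hcard
  have hW := card_blkOf_le D.toDomains y'
  calc (((Finset.univ.filter fun b' : PBond (PV d ℓ m K hd hL) 0 => blkV1 hN D b' = y').card : ℕ) : ℝ)
      ≤ (((Finset.univ.filter fun z : ↥(boxDom (N0 ℓ Mh k P')) => blkOf D.toDomains z = y').card * (d + 1) : ℕ) : ℝ) := by
        exact_mod_cast hcard
    _ ≤ ((d : ℝ) + 1) * W D.toDomains y' := by
        push_cast
        nlinarith [hW, (show (0 : ℝ) ≤ (d : ℝ) + 1 by positivity)]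

include hk in
/-- **THE (2.88) ENTRY BOUND TRANSFERS TO THE `hDg` SLOT.**  If p21's matrix `(S_μ − 1)(1 − Rm)(S_ν − 1)ᵀ` (`= ∂_μP∂_ν*` in lattice units) satisfies, for
all directions and sites, `|entry(z, z′)| ≤ C·len(y)^{−2}·W(y′)^{−1}·e^{−δd_T(y,y′)}` with `y = blkOf z`, `y′ = blkOf z′` (the shape of (2.88):
`(L^jη)^{−2}(L^{j′}η)^{−d}` times the sum over the `W(y′) = (L^{j′})^{d+1}` sites of `B(y′)`), then V1's `Dg = onFun (∂(1 − R)∂*)` has the block majorant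
`c²(d+1)C·len(y)^{−2}·e^{−δd_T(y,y′)}` on `geomT D` with the block map `blkV1 hN D` — the hypothesis `hDg`/`hPl` of the (2.134) consumers for the GLOBAL
`∂P∂*`. [cite: Balaban1984PropagatorsII, (2.88) p.238, (2.134) p.247] -/
theorem hasMajorant_Dg_chart {c : ℝ} (hc : c ≠ 0) (Rm : Matrix ↥(boxDom (N0 ℓ Mh k P')) ↥(boxDom (N0 ℓ Mh k P')) ℝ) (hs : Rm.IsSymm)
    (hr : ∀ f : ↥(boxDom (N0 ℓ Mh k P')) → ℝ, ∃ lam : ↥(boxDom (N0 ℓ Mh k P')) → ℝ,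
      QB D.toDomains lam = 0 ∧ Rm *ᵥ f = perLapT (N0 ℓ Mh k P') *ᵥ lam)
    (hf : ∀ lam : ↥(boxDom (N0 ℓ Mh k P')) → ℝ, QB D.toDomains lam = 0 →
      Rm *ᵥ (perLapT (N0 ℓ Mh k P') *ᵥ lam) = perLapT (N0 ℓ Mh k P') *ᵥ lam)
    {C δ : ℝ} (hC : 0 ≤ C)
    (hB : ∀ (μ ν : Fin (d + 1)) (z z' : ↥(boxDom (N0 ℓ Mh k P'))),
      |((shiftMat (N0 ℓ Mh k P') (unitVec μ) - 1) * (1 - Rm) * (shiftMat (N0 ℓ Mh k P') (unitVec ν) - 1)ᵀ :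
          Matrix ↥(boxDom (N0 ℓ Mh k P')) ↥(boxDom (N0 ℓ Mh k P')) ℝ) z z'| ≤
        C / (geomT D).len (blkOf D.toDomains z) ^ 2 / W D.toDomains (blkOf D.toDomains z') *
          Real.exp (-(δ * (geomT D).dist (blkOf D.toDomains z) (blkOf D.toDomains z')))) :
    HasMajorant (g := geomT D) (blkV1 hN D) (onFun (dE c ∘ₗ (LinearMap.id - RE (domT hN D hk) c) ∘ₗ dsE c))
      (fun y y' => c ^ 2 * ((d : ℝ) + 1) * C / (geomT D).len y ^ 2 * Real.exp (-(δ * (geomT D).dist y y'))) := by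
  classical
  intro y' μ B hμ b
  rw [onFun_apply]
  set T : BondSpace (PV d ℓ m K hd hL) →ₗ[ℝ] BondSpace (PV d ℓ m K hd hL) := dE c ∘ₗ (LinearMap.id - RE (domT hN D hk) c) ∘ₗ dsE c with hT
  -- the pointwise expansion over the source bonds, restricted to the block `y′`
  have h1 := B6BlockDecayCalculus.abs_apply_le_sum T (WithLp.toLp 2 μ) b
  have hE : ∀ b' : PBond (PV d ℓ m K hd hL) 0, blkV1 hN D b' = y' →
      |T (EuclideanSpace.single b' (1 : ℝ)) b| ≤
        c ^ 2 * (C / (geomT D).len (blkV1 hN D b) ^ 2 / W D.toDomains y' * Real.exp (-(δ * (geomT D).dist (blkV1 hN D b) y'))) := by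
    intro b' hb'
    rw [hT, Dg_single hN D hk hc Rm hs hr hf b b', abs_mul, abs_of_nonneg (sq_nonneg c)]
    refine mul_le_mul_of_nonneg_left ?_ (sq_nonneg c)
    have := hB b.dir b'.dir (toBox hN b.src) (toBox hN b'.src)
    rw [← hb']
    exact this
  have hK0 : 0 ≤ c ^ 2 * (C / (geomT D).len (blkV1 hN D b) ^ 2 / W D.toDomains y' * Real.exp (-(δ * (geomT D).dist (blkV1 hN D b) y'))) :=
    mul_nonneg (sq_nonneg c) (mul_nonneg (div_nonneg (div_nonneg hC (sq_nonneg _)) (W_pos _ _).le) (Real.exp_nonneg _))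
  have h2 : ∑ b' : PBond (PV d ℓ m K hd hL) 0, |T (EuclideanSpace.single b' (1 : ℝ)) b| * |(WithLp.toLp 2 μ : BondSpace (PV d ℓ m K hd hL)) b'| ≤
      ∑ b' ∈ Finset.univ.filter (fun b' : PBond (PV d ℓ m K hd hL) 0 => blkV1 hN D b' = y'),
        c ^ 2 * (C / (geomT D).len (blkV1 hN D b) ^ 2 / W D.toDomains y' * Real.exp (-(δ * (geomT D).dist (blkV1 hN D b) y'))) * B := by
    rw [← Finset.sum_filter_add_sum_filter_not Finset.univ (fun b' : PBond (PV d ℓ m K hd hL) 0 => blkV1 hN D b' = y')]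
    have hzero : ∑ b' ∈ Finset.univ.filter (fun b' : PBond (PV d ℓ m K hd hL) 0 => ¬ blkV1 hN D b' = y'),
        |T (EuclideanSpace.single b' (1 : ℝ)) b| * |(WithLp.toLp 2 μ : BondSpace (PV d ℓ m K hd hL)) b'| = 0 := by
      refine Finset.sum_eq_zero fun b' hb' => ?_
      rw [Finset.mem_filter] at hb'
      rw [show (WithLp.toLp 2 μ : BondSpace (PV d ℓ m K hd hL)) b' = μ b' from rfl, hμ.off b' hb'.2, abs_zero, mul_zero]
    rw [hzero, add_zero]
    refine Finset.sum_le_sum fun b' hb' => ?_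
    rw [Finset.mem_filter] at hb'
    rw [show (WithLp.toLp 2 μ : BondSpace (PV d ℓ m K hd hL)) b' = μ b' from rfl]
    exact mul_le_mul (hE b' hb'.2) (hμ.bound b' hb'.2) (abs_nonneg _) hK0
  rw [Finset.sum_const, nsmul_eq_mul] at h2
  refine (h1.trans h2).trans ?_
  have hcard := card_bonds_blkV1_le hN D y'
  have hWpos := W_pos D.toDomains y'
  calc (((Finset.univ.filter fun b' : PBond (PV d ℓ m K hd hL) 0 => blkV1 hN D b' = y').card : ℕ) : ℝ) *
        (c ^ 2 * (C / (geomT D).len (blkV1 hN D b) ^ 2 / W D.toDomains y' * Real.exp (-(δ * (geomT D).dist (blkV1 hN D b) y'))) * B)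
      ≤ ((d : ℝ) + 1) * W D.toDomains y' *
        (c ^ 2 * (C / (geomT D).len (blkV1 hN D b) ^ 2 / W D.toDomains y' * Real.exp (-(δ * (geomT D).dist (blkV1 hN D b) y'))) * B) :=
        mul_le_mul_of_nonneg_right hcard (mul_nonneg hK0 hμ.nonneg)
    _ = c ^ 2 * ((d : ℝ) + 1) * C / (geomT D).len (blkV1 hN D b) ^ 2 * Real.exp (-(δ * (geomT D).dist (blkV1 hN D b) y')) * B := by
        field_simp

end Majorant

end Literature.MathematicalPhysics.QuantumFieldTheory.Balaban1983to89.B6ScalarChartV1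

end
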